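import Summits.CriticalPhenomena.PercolationContinuityZ3.Theorems.PercNearOneGluingAdditiveGluingConeBlockGood
import HarnessLib

/-! # Crux `PercNearOneGluing.AdditiveGluing` (stmt-CriticalPhenomena-4576), line `peel` — skeleton v4's REAL part:
# the cone step from BYSTANDER ATTACHMENT and the DOUBLE-DRIFT residual (part 1/2)

Lead c5; lands `--supports stmt-CriticalPhenomena-4576`.  No definitions, no named facts.  CONDITIONAL on two spelled-out hypotheses:
`bystanderGood` (for any designation `d ≠ x`: `insert x T` is `d`-good in `u` as soon as every layer block `T ∪ B` of positive layer
mass is `d`-good in the star-killed weighting `u − x` — proved in work/BystanderGood.lean from the landed σ-identities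
`stub_bystanderReach/Designated/Pockets_c5`, registered handle `stub_bystanderGood_c5`) and `coneDoubleDrift` (the registered residual
`stub_coneDoubleDrift`: the cone growth step when for EVERY non-isolated vertex `x'` of `insert x T` every minimiser `a'` of
`μ_{u−x'}(· ↔ b)` strictly overtakes `a₀` after gluing `insert x T`, with the `a'`-goodness of the block for every such pair handed in).
Part 1: a block containing the target is good; the cone chain inside one weighting (`coneDD_chain_local`).  Part 2: `coneDD_conePeel_of`
(strong induction on the number of positive-degree vertices; bystander route through every vertex of the block; isolated bystander;
Lemma-5 leaf `blockGood_leaf_lemma5`; drift split) the content theorem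
`coneDD_conePeel_of : bystanderGood → coneDoubleDrift → conePeel` (registration handle of part 2: `stub_coneDDStarKill_c5`); the crux by
name is then `coneLine_additiveGluing_of (coneDD_conePeel_of h₁ h₂)` (landed …ConeAssembly.lean).  Numerics (lead c5, exact engine, n ≤ 8): total double drift in ≈ 0.1 % of bad instances, 0 violations.
[cite: KozmaNitzan2024, §3.2 Definition p. 12, Thms 4–5 pp. 12–14, Lemma 5 p. 13, Question 7 & 9 p. 36]
-/

namespace Summit.CriticalPhenomena.PercolationContinuityZ3.Theorems

open MeasureTheory Set
open Literature.Probability.LatticeModels (prodBernoulli)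
open Literature.Probability.Percolation (BondConfig openConn openConnIn openGraph openCluster)
open scoped BigOperators Classical

noncomputable section

variable {n : ℕ}

/-- A block containing the target is good at every designation (its reach is `1`). [folklore] -/
theorem coneDD_blockGood_of_target_mem (u : Sym2 (Fin n) → unitInterval) (A S : Finset (Fin n)) (b d : Fin n) (hb : b ∈ A)
    (hbS : b ∈ S) :
    (prodBernoulli u).real (openConn d b)
          + (prodBernoulli u).real
              ((openConn d b)ᶜ ∩ (⋃ v ∈ S, openConn d v) ∩ (⋃ v ∈ S, openConn v b))
        ≤ (prodBernoulli u).real (⋃ v ∈ S, openConn v b)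
          + (∑ W ∈ (Finset.univ : Finset (Finset (Fin n))).filter (fun W => Disjoint W A),
              (prodBernoulli u).real
                  {ω : BondConfig (Fin n) | ∀ z : Fin n, (z ∈ W ↔ ω ∈ ⋃ v ∈ S, openConn v z)}
                * A.inf' ⟨b, hb⟩ (fun a => (prodBernoulli u).real (openConnIn ((W : Set (Fin n))ᶜ) a b))) := by
  have h1 : (prodBernoulli u).real (⋃ v ∈ S, openConn v b) = 1 := by
    have : (⋃ v ∈ S, (openConn v b : Set (BondConfig (Fin n)))) = Set.univ := by
      refine Set.eq_univ_of_forall fun ω => Set.mem_iUnion₂.2 ⟨b, hbS, ?_⟩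
      exact (SimpleGraph.Reachable.refl b : (openGraph ω).Reachable b b)
    rw [this, probReal_univ]
  have h2 : (prodBernoulli u).real (openConn d b)
          + (prodBernoulli u).real
              ((openConn d b)ᶜ ∩ (⋃ v ∈ S, openConn d v) ∩ (⋃ v ∈ S, openConn v b)) ≤ 1 := by
    rw [← measureReal_union (Set.disjoint_left.2 fun ω hω hω' => hω'.1.1 hω) MeasurableSet.of_discrete]
    exact measureReal_le_one
  have hinf_nonneg : ∀ W : Finset (Fin n),
      0 ≤ A.inf' ⟨b, hb⟩ (fun a => (prodBernoulli u).real (openConnIn ((W : Set (Fin n))ᶜ) a b)) :=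
    fun W => Finset.le_inf' _ _ fun a _ => measureReal_nonneg
  have h3 : 0 ≤ (∑ W ∈ (Finset.univ : Finset (Finset (Fin n))).filter (fun W => Disjoint W A),
              (prodBernoulli u).real
                  {ω : BondConfig (Fin n) | ∀ z : Fin n, (z ∈ W ↔ ω ∈ ⋃ v ∈ S, openConn v z)}
                * A.inf' ⟨b, hb⟩ (fun a => (prodBernoulli u).real (openConnIn ((W : Set (Fin n))ᶜ) a b))) :=
    Finset.sum_nonneg fun W _ => mul_nonneg measureReal_nonneg (hinf_nonneg W)
  linarith

/-- **The cone chain inside ONE weighting** (as `coneLine_blockGood`, with the cone steps of this weighting handed in): block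
goodness (worst selection) of a bad block `S ∋ s` at a minimiser `a₀`, from point goodness of `s` (the induction hypothesis) and the
cone steps of `u` at `a₀`. [cite: KozmaNitzan2024, §3.2 pp. 12–14] -/
theorem coneDD_chain_local (u : Sym2 (Fin n) → unitInterval) (A S : Finset (Fin n)) (b a₀ s : Fin n) (hb : b ∈ A)
    (hSA : Disjoint S A) (hs : s ∈ S)
    (hmin : (∀ a ∈ A, (prodBernoulli u).real (openConn a₀ b) ≤ (prodBernoulli u).real (openConn a b)))
    (hbad : ∀ v ∈ S, (prodBernoulli u).real (openConn v b) < (prodBernoulli u).real (openConn a₀ b))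
    (hIH : (∀ w' : Sym2 (Fin n) → unitInterval,
        (Finset.univ.filter (fun v : Fin n => ∃ y : Fin n, 0 < (w' s(y, v) : ℝ))).card
          ≤ (Finset.univ.filter (fun v : Fin n => ∃ y : Fin n, 0 < (u s(y, v) : ℝ))).card →
        ∀ (A' : Finset (Fin n)) (o' b' : Fin n), b' ∈ A' → o' ∉ A' →
        ∀ (t : ℝ) (sel : Finset (Fin n) → Fin n), (∀ W, sel W ∈ A') →
          (∀ a ∈ A', 1 - t ≤ (prodBernoulli w').real (openConn a b')) →
          (prodBernoulli w').real ((⋃ a ∈ A', openConn o' a) ∩ (openConn o' b')ᶜ)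
            + ∑ W ∈ (Finset.univ : Finset (Finset (Fin n))).filter (fun W => o' ∈ W ∧ Disjoint W A'),
                (prodBernoulli w').real {ω : BondConfig (Fin n) | openCluster ω o' = (W : Set (Fin n))}
                  * (prodBernoulli w').real (openConnIn ((W : Set (Fin n))ᶜ) (sel W) b')ᶜ
            ≤ t))
    (hconeU : ∀ (T : Finset (Fin n)) (x : Fin n), Disjoint T A → T.Nonempty → x ∉ A → x ∉ T →
      (∀ v ∈ insert x T, (prodBernoulli u).real (openConn v b) < (prodBernoulli u).real (openConn a₀ b)) →
      (prodBernoulli u).real (openConn a₀ b)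
          + (prodBernoulli u).real
              ((openConn a₀ b)ᶜ ∩ (⋃ v ∈ T, openConn a₀ v) ∩ (⋃ v ∈ T, openConn v b))
        ≤ (prodBernoulli u).real (⋃ v ∈ T, openConn v b)
          + (∑ W ∈ (Finset.univ : Finset (Finset (Fin n))).filter (fun W => Disjoint W A),
              (prodBernoulli u).real
                  {ω : BondConfig (Fin n) | ∀ z : Fin n, (z ∈ W ↔ ω ∈ ⋃ v ∈ T, openConn v z)}
                * A.inf' ⟨b, hb⟩ (fun a => (prodBernoulli u).real (openConnIn ((W : Set (Fin n))ᶜ) a b))) →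
      (prodBernoulli u).real (openConn a₀ b)
          + (prodBernoulli u).real
              ((openConn a₀ b)ᶜ ∩ (⋃ v ∈ insert x T, openConn a₀ v) ∩ (⋃ v ∈ insert x T, openConn v b))
        ≤ (prodBernoulli u).real (⋃ v ∈ insert x T, openConn v b)
          + (∑ W ∈ (Finset.univ : Finset (Finset (Fin n))).filter (fun W => Disjoint W A),
              (prodBernoulli u).real
                  {ω : BondConfig (Fin n) | ∀ z : Fin n, (z ∈ W ↔ ω ∈ ⋃ v ∈ insert x T, openConn v z)}
                * A.inf' ⟨b, hb⟩ (fun a => (prodBernoulli u).real (openConnIn ((W : Set (Fin n))ᶜ) a b)))) :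
    (prodBernoulli u).real (openConn a₀ b)
          + (prodBernoulli u).real
              ((openConn a₀ b)ᶜ ∩ (⋃ v ∈ S, openConn a₀ v) ∩ (⋃ v ∈ S, openConn v b))
        ≤ (prodBernoulli u).real (⋃ v ∈ S, openConn v b)
          + (∑ W ∈ (Finset.univ : Finset (Finset (Fin n))).filter (fun W => Disjoint W A),
              (prodBernoulli u).real
                  {ω : BondConfig (Fin n) | ∀ z : Fin n, (z ∈ W ↔ ω ∈ ⋃ v ∈ S, openConn v z)}
                * A.inf' ⟨b, hb⟩ (fun a => (prodBernoulli u).real (openConnIn ((W : Set (Fin n))ᶜ) a b))) := by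
  have hsA : s ∉ A := Finset.disjoint_left.1 hSA hs
  -- point goodness of `s` (worst selection) from the induction hypothesis applied to `u` itself
  have hex : ∀ W : Finset (Fin n), ∃ a, a ∈ A ∧
      A.inf' ⟨b, hb⟩ (fun a => (prodBernoulli u).real (openConnIn ((W : Set (Fin n))ᶜ) a b)) =
        (prodBernoulli u).real (openConnIn ((W : Set (Fin n))ᶜ) a b) :=
    fun W => Finset.exists_mem_eq_inf' ⟨b, hb⟩ _
  choose selm hselmA hselm using hex
  have hpt := hIH u le_rfl A s b hb hsA (1 - (prodBernoulli u).real (openConn a₀ b)) selm hselmA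
    (fun a ha => by linarith [hmin a ha])
  rw [goodStep24_functional_eq u A s b hb selm] at hpt
  have hZpt_eq : ∑ W ∈ (Finset.univ : Finset (Finset (Fin n))).filter (fun W => s ∈ W ∧ Disjoint W A),
      (prodBernoulli u).real {ω : BondConfig (Fin n) | openCluster ω s = (W : Set (Fin n))}
        * (prodBernoulli u).real (openConnIn ((W : Set (Fin n))ᶜ) (selm W) b)
      = (∑ W ∈ (Finset.univ : Finset (Finset (Fin n))).filter (fun W => s ∈ W ∧ Disjoint W A),
          (prodBernoulli u).real {ω : BondConfig (Fin n) | openCluster ω s = (W : Set (Fin n))}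
            * A.inf' ⟨b, hb⟩ (fun a => (prodBernoulli u).real (openConnIn ((W : Set (Fin n))ᶜ) a b))) := by
    refine Finset.sum_congr rfl fun W _ => ?_
    rw [hselm W]
  rw [hZpt_eq] at hpt
  have hpoint : (prodBernoulli u).real (openConn a₀ b) ≤ (prodBernoulli u).real (openConn s b)
      + (∑ W ∈ (Finset.univ : Finset (Finset (Fin n))).filter (fun W => s ∈ W ∧ Disjoint W A),
          (prodBernoulli u).real {ω : BondConfig (Fin n) | openCluster ω s = (W : Set (Fin n))}
            * A.inf' ⟨b, hb⟩ (fun a => (prodBernoulli u).real (openConnIn ((W : Set (Fin n))ᶜ) a b))) := by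
    linarith
  -- the chain over sub-blocks `T ∋ s` of `S`
  have hchain : ∀ (m : ℕ) (T : Finset (Fin n)), T ⊆ S → s ∈ T → T.card = m →
      (prodBernoulli u).real (openConn a₀ b)
          + (prodBernoulli u).real
              ((openConn a₀ b)ᶜ ∩ (⋃ v ∈ T, openConn a₀ v) ∩ (⋃ v ∈ T, openConn v b))
        ≤ (prodBernoulli u).real (⋃ v ∈ T, openConn v b)
          + (∑ W ∈ (Finset.univ : Finset (Finset (Fin n))).filter (fun W => Disjoint W A),
              (prodBernoulli u).real
                  {ω : BondConfig (Fin n) | ∀ z : Fin n, (z ∈ W ↔ ω ∈ ⋃ v ∈ T, openConn v z)}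
                * A.inf' ⟨b, hb⟩ (fun a => (prodBernoulli u).real (openConnIn ((W : Set (Fin n))ᶜ) a b))) := by
    intro m
    induction m using Nat.strong_induction_on with
    | _ m ih =>
      intro T hTS hsT hTm
      by_cases hT1 : T.card = 1
      · obtain ⟨y, hy⟩ := Finset.card_eq_one.1 hT1
        have hys : y = s := by
          have : s ∈ ({y} : Finset (Fin n)) := hy ▸ hsT
          exact (Finset.mem_singleton.1 this).symm
        subst hys
        rw [hy]
        exact coneLine_blockGood_singleton u A b a₀ y hb hpoint
      · have hT2 : 2 ≤ T.card := by
          have h0 : 0 < T.card := Finset.card_pos.2 ⟨s, hsT⟩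
          omega
        obtain ⟨x, hx⟩ : ∃ x, x ∈ T.erase s :=
          Finset.card_pos.1 (by rw [Finset.card_erase_of_mem hsT]; omega)
        have hxT : x ∈ T := Finset.mem_of_mem_erase hx
        have hxs : x ≠ s := Finset.ne_of_mem_erase hx
        have hsub : T.erase x ⊆ S := (Finset.erase_subset x T).trans hTS
        have hsT' : s ∈ T.erase x := Finset.mem_erase.2 ⟨hxs.symm, hsT⟩
        have hcard' : (T.erase x).card = T.card - 1 := Finset.card_erase_of_mem hxT
        have IH := ih (T.card - 1) (by omega) (T.erase x) hsub hsT' hcard'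
        have hTA' : Disjoint (T.erase x) A := Finset.disjoint_of_subset_left hsub hSA
        have hxA : x ∉ A := Finset.disjoint_left.1 hSA (hTS hxT)
        have hxT' : x ∉ T.erase x := Finset.notMem_erase x T
        have hins : insert x (T.erase x) = T := Finset.insert_erase hxT
        have hbad' : ∀ v ∈ insert x (T.erase x),
            (prodBernoulli u).real (openConn v b) < (prodBernoulli u).real (openConn a₀ b) :=
          fun v hv => hbad v (hTS (hins ▸ hv))
        have h := hconeU (T.erase x) x hTA' ⟨s, hsT'⟩ hxA hxT' hbad' IH
        rw [hins] at h
        exact h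
  exact hchain S.card S (subset_refl S) hs rfl


/-- Registered stub `stub_coneChainLocal_c5` of crux stmt-CriticalPhenomena-4576 (lead c5, skeleton v4, part 1/2): the cone chain inside
one weighting (fully spelled statement; = `coneDD_chain_local`). [cite: KozmaNitzan2024, §3.2 pp. 12–14] -/
theorem stub_coneChainLocal_c5 : ∀ (n : ℕ) (u : Sym2 (Fin n) → unitInterval) (A S : Finset (Fin n)) (b a₀ s : Fin n) (hb : b ∈ A) (hSA : Disjoint S A) (hs : s ∈ S) (hmin : (∀ a ∈ A, (prodBernoulli u).real (openConn a₀ b) ≤ (prodBernoulli u).real (openConn a b))) (hbad : ∀ v ∈ S, (prodBernoulli u).real (openConn v b) < (prodBernoulli u).real (openConn a₀ b)) (hIH : (∀ w' : Sym2 (Fin n) → unitInterval, (Finset.univ.filter (fun v : Fin n => ∃ y : Fin n, 0 < (w' s(y, v) : ℝ))).card ≤ (Finset.univ.filter (fun v : Fin n => ∃ y : Fin n, 0 < (u s(y, v) : ℝ))).card → ∀ (A' : Finset (Fin n)) (o' b' : Fin n), b' ∈ A' → o' ∉ A' → ∀ (t : ℝ) (sel : Finset (Fin n) → Fin n), (∀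 W, sel W ∈ A') → (∀ a ∈ A', 1 - t ≤ (prodBernoulli w').real (openConn a b')) → (prodBernoulli w').real ((⋃ a ∈ A', openConn o' a) ∩ (openConn o' b')ᶜ) + ∑ W ∈ (Finset.univ : Finset (Finset (Fin n))).filter (fun W => o' ∈ W ∧ Disjoint W A'), (prodBernoulli w').real {ω : BondConfig (Fin n) | openCluster ω o' = (W : Set (Fin n))} * (prodBernoulli w').real (openConnIn ((W : Set (Fin n))ᶜ) (sel W) b')ᶜ ≤ t)) (hconeU : ∀ (T : Finset (Fin n)) (x : Fin n), Disjoint T A → T.Nonempty → x ∉ A → x ∉ T → (∀ v ∈ insert x T, (prodBernoulli u).real (openConn v b) < (prodBernoulli u).real (openConn a₀ b)) → (prodBernoulli u).real (openConn a₀ b) + (prodBernoulli u).real ((openConn a₀ b)ᶜ ∩ (⋃ v ∈ T, openConn a₀ v) ∩ (⋃ v ∈ T, openConn v b)) ≤ (prodBernoulli u).real (⋃ v ∈ T, openConn v b) + (∑ W ∈ (Finset.univ : Finset (Finset (Fin n))).filter (fun W => Disjoint W A), (prodBernoulli u).real {ω : BondConfig (Fin n) | ∀ z : Fin n, (z ∈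 W ↔ ω ∈ ⋃ v ∈ T, openConn v z)} * A.inf' ⟨b, hb⟩ (fun a => (prodBernoulli u).real (openConnIn ((W : Set (Fin n))ᶜ) a b))) → (prodBernoulli u).real (openConn a₀ b) + (prodBernoulli u).real ((openConn a₀ b)ᶜ ∩ (⋃ v ∈ insert x T, openConn a₀ v) ∩ (⋃ v ∈ insert x T, openConn v b)) ≤ (prodBernoulli u).real (⋃ v ∈ insert x T, openConn v b) + (∑ W ∈ (Finset.univ : Finset (Finset (Fin n))).filter (fun W => Disjoint W A), (prodBernoulli u).real {ω : BondConfig (Fin n) | ∀ z : Fin n, (z ∈ W ↔ ω ∈ ⋃ v ∈ insert x T, openConn v z)} * A.inf' ⟨b, hb⟩ (fun a => (prodBernoulli u).real (openConnIn ((W : Set (Fin n))ᶜ) a b)))), (prodBernoulli u).real (openConn a₀ b) + (prodBernoulli u).real ((openConn a₀ b)ᶜ ∩ (⋃ v ∈ S, openConn a₀ v) ∩ (⋃ v ∈ S, openConn v b)) ≤ (prodBernoulli u).real (⋃ v ∈ S, openConn v b) + (∑ W ∈ (Finset.univ : Finset (Finset (Fin n))).filter (fun W => Disjoint W A), (prodBernoulli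 u).real {ω : BondConfig (Fin n) | ∀ z : Fin n, (z ∈ W ↔ ω ∈ ⋃ v ∈ S, openConn v z)} * A.inf' ⟨b, hb⟩ (fun a => (prodBernoulli u).real (openConnIn ((W : Set (Fin n))ᶜ) a b))) :=
  fun _ u A S b a₀ s hb hSA hs hmin hbad hIH hconeU => coneDD_chain_local u A S b a₀ s hb hSA hs hmin hbad hIH hconeU

end

end Summit.CriticalPhenomena.PercolationContinuityZ3.Theorems
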